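import Literature.NumberTheory.EllipticCurves.LocalKummerMap
import Literature.NumberTheory.EllipticCurves.KummerSequenceConnecting
import HarnessLib

/-!
# The local Kummer sequence is exact on the right: `H¹(E, E[n]) → H¹(E, E)[n] → 0`

Topic `NumberTheory/EllipticCurves`; namespace `WeierstrassCurve`. Definitions with bodies and theorems
only: **no named fact is introduced** (D-0026).

For an elliptic curve `E = W` over a field `K` of characteristic `0`, a `K`-field `E` (a completion
`K_v`) and `n ≠ 0`, the change of coefficients
`H¹(Γ_E, E[n](K̄)|_{Γ_E}) → H¹(Γ_E, E(K̄_E))` (`galoisCohomology.map (torsionPointsMapIntertwining n E) 1`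
of `KummerSelmerStructure.lean`, whose kernel is the local Kummer condition `𝓛_E`) has image
**exactly the `n`-torsion `H¹(E, E)[n]`** — the right half of the exact rows
`0 → E(K_v)/nE(K_v) → H¹(G_v, E[n]) → H¹(G_v, E)[n] → 0` of Silverman, *AEC*, X.§4, diagram (**)
(and of Milne, *ADT*, I §6, diagram in the proof of Thm. 6.13(b) / Lemma 6.15):

* `pointsLocalIso W E : (W⁄E)(Ē) ≅ E(K̄_E)` as discrete `Γ_E`-modules (the tree's
  `baseChangeGeomPointsEquiv`, equivariant), and the commutative square on `H¹`
  `(pointsMap)_* ∘ H¹(torsion transfer) = H¹(pointsLocalIso) ∘ H¹(E[n] ↪ E)`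
  (`map_torsionPointsMapIntertwining_cohomologyMap_torsionTransferInvHom`);
* **`exists_map_torsionPointsMapIntertwining_eq_of_zsmul_eq_zero`**: every `a ∈ H¹(Γ_E, E(K̄_E))`
  with `n • a = 0` is the image of a class of `H¹(Γ_E, E[n](K̄)|_{Γ_E})` (exactness of the long exact
  sequence of the Kummer sequence `0 → E[n] → E(Ē) →ⁿ E(Ē) → 0` of `W⁄E` at `H¹(E(Ē))`, tree
  `kummer_isSES`, `IsSES.exists_map_one_eq_of_map_one_eq_zero`, `H¹([n]) = n`);
* `zsmul_map_torsionPointsMapIntertwining` (the image is `n`-torsion) and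
  `mem_range_map_torsionPointsMapIntertwining_iff : a ∈ im ↔ n • a = 0`;
* the **order relation `#H¹(E, E)[n] · #𝓛_E = #H¹(E, E[n])`**
  (`natCard_torsionBy_mul_natCard_kummerLocalConditionAt`, first isomorphism theorem), which with
  `#𝓛_{K_v} = #E(K_v)/n` (`LocalKummerMap.lean`), local Tate duality for `E[n]`
  (`LocalWeilPairingDuality.lean`) and Tate's local Euler characteristic gives Milne I Thm. 3.2's
  `#H¹(K_v, E)[n] = #E(K_v)/n`.

Motivation: provefact `WeierstrassCurve.exists_casselsTate_pairing` (Silverman *AEC* X.4.14; Milne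
*ADT* I.6.13(a)).

## References

* [SilvermanAEC2009] J. H. Silverman, *The Arithmetic of Elliptic Curves*, 2nd ed. (2009), VIII.§2
  (the Kummer sequence), X.§4 (diagram (**) before Thm. X.4.2).
* [MilneADT2006] J. S. Milne, *Arithmetic Duality Theorems*, 2nd ed. (2006), Ch. I, Thm. 3.2,
  Lemma 3.3, §6 (proof of Thm. 6.13(b), Lemma 6.15).
-/

noncomputable section

open scoped Classical

universe u

namespace WeierstrassCurve

open CategoryTheory Literature.NumberTheory.EllipticCurves Literature.NumberTheory.GaloisRepresentations
  Field

variable {K : Type u} [Field K] (W : WeierstrassCurve K)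
variable (E : Type u) [Field E] [Algebra K E]

/-! ## `(W⁄E)(Ē) ≅ E(K̄_E)` as discrete `Γ_E`-modules -/

/-- **`(W⁄E)(Ē) ≅ E(K̄_E)` as discrete `Γ_E`-modules**: the tree's `baseChangeGeomPointsEquiv`
(identity on coordinates, `Γ_E`-equivariant by `baseChangeGeomPointsEquiv_smul`) as an isomorphism
of the topological representations `(W⁄E).galoisModule`, `W.localGaloisModule E`
(tree constructor `topRepIsoOfEquiv`). [folklore] -/
def pointsLocalIso :
    (W.baseChange E).galoisModule.toTopRep ≅ (W.localGaloisModule E).toTopRep :=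
  topRepIsoOfEquiv (X := (W.baseChange E).galoisModule.toTopRep)
    (Y := (W.localGaloisModule E).toTopRep)
    { (W.baseChangeGeomPointsEquiv E).toIntLinearEquiv with
      continuous_toFun := continuous_of_discreteTopology
      continuous_invFun := continuous_of_discreteTopology }
    fun σ P => W.baseChangeGeomPointsEquiv_smul E σ P

/-- Unfolding `pointsLocalIso`. [folklore] -/
@[simp]
theorem pointsLocalIso_hom_apply (P : geomPoints (W.baseChange E)) :
    (W.pointsLocalIso E).hom.hom P = W.baseChangeGeomPointsEquiv E P :=
  rfl

variable [CharZero K] [W.IsElliptic] {n : ℤ}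

/-- **The square `(pointsMap)_* ∘ H¹(A⁻¹) = H¹(e) ∘ H¹(ι)`** on `H¹(E, (W⁄E)[n])`: changing
coefficients along the torsion transfer `A⁻¹ : (W⁄E)[n] → E[n](K̄)|_{Γ_E}` and then along
`pointsMap : E[n](K̄) → E(K̄_E)` agrees with `H¹` of the inclusion `(W⁄E)[n] ↪ (W⁄E)(Ē)` followed by
`(W⁄E)(Ē) ≅ E(K̄_E)` (pointwise `pointsMap (A⁻¹ S) = e S`, tree `pointsMap_torsionTransferEquiv_symm`).
[folklore] -/
theorem map_torsionPointsMapIntertwining_cohomologyMap_torsionTransferInvHom (hn : n ≠ 0)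
    (c : galH1Torsion (W.baseChange E) n) :
    galoisCohomology.map (W.torsionPointsMapIntertwining n E) 1
        (cohomologyMap (W.torsionTransferInvHom (E := E) hn) 1 c) =
      cohomologyMap (W.pointsLocalIso E).hom 1
        (cohomologyMap ((W.baseChange E).torsionInclGaloisModuleHom n) 1 c) := by
  obtain ⟨φ, rfl⟩ := oneCocycleClass_surjective ((W.baseChange E).torsionGaloisModule n).toTopRep c
  rw [cohomologyMap_oneCocycleClass, map_torsionPointsMapIntertwining_oneCocycleClass,
    cohomologyMap_oneCocycleClass, cohomologyMap_oneCocycleClass]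
  refine congrArg (oneCocycleClass _) (Subtype.ext (ContinuousMap.ext fun σ => ?_))
  change pointsMap W E ((W.torsionTransferEquiv (E := E) hn).symm (φ.1 σ) : geomTorsion W n) =
    W.baseChangeGeomPointsEquiv E ((φ.1 σ : geomTorsion (W.baseChange E) n) :
      geomPoints (W.baseChange E))
  exact W.pointsMap_torsionTransferEquiv_symm (E := E) hn (φ.1 σ)

variable [CharZero E]

/-- **Exactness of the local Kummer sequence at `H¹(E, E)[n]`**: every class `a ∈ H¹(Γ_E, E(K̄_E))`
with `n • a = 0` is the image of a class of `H¹(Γ_E, E[n](K̄)|_{Γ_E})` under the change of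
coefficients `pointsMap` — i.e. `H¹(E, E[n]) → H¹(E, E)[n]` is surjective.  Proof: the long exact
sequence of the Kummer sequence `0 → (W⁄E)[n] → (W⁄E)(Ē) →ⁿ (W⁄E)(Ē) → 0` (tree `kummer_isSES`,
`IsSES.exists_map_one_eq_of_map_one_eq_zero`, `H¹([n]) = n`) transported along `pointsLocalIso` and
`torsionTransferInvHom`. Silverman, *AEC*, X.§4, diagram (**) (`… → H¹(G_v, E)[m] → 0`); VIII.§2.
[cite: SilvermanAEC2009, X.§4 diagram (**)] -/
theorem exists_map_torsionPointsMapIntertwining_eq_of_zsmul_eq_zero (hn : n ≠ 0)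
    (a : galoisCohomology (W.localGaloisModule E) 1) (ha : n • a = 0) :
    ∃ b : galoisCohomology (GaloisRep.restrictField E (W.torsionGaloisModule n)) 1,
      galoisCohomology.map (W.torsionPointsMapIntertwining n E) 1 b = a := by
  -- work with the carrier of Mathlib's `continuousCohomology` (of which `galoisCohomology` is a copy)
  suffices key : ∀ a₀ : continuousCohomology 1 (W.localGaloisModule E).toTopRep, n • a₀ = 0 →
      ∃ b : galoisCohomology (GaloisRep.restrictField E (W.torsionGaloisModule n)) 1,
        galoisCohomology.map (W.torsionPointsMapIntertwining n E) 1 b = a₀ from key a ha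
  intro a₀ ha₀
  -- pull `a₀` back to `H¹(E, (W⁄E)(Ē))`
  let a' : continuousCohomology 1 (W.baseChange E).galoisModule.toTopRep :=
    (cohomologyMap (W.pointsLocalIso E).inv 1).hom a₀
  have hna' : n • a' = 0 := by
    change n • (cohomologyMap (W.pointsLocalIso E).inv 1).hom a₀ = 0
    rw [← map_zsmul, ha₀, map_zero]
  have hy : cohomologyMap ((W.baseChange E).zsmulGaloisModuleHom n) 1 a' = 0 :=
    ((W.baseChange E).cohomologyMap_zsmulGaloisModuleHom_one n a').trans hna'
  obtain ⟨b', hb'⟩ :=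
    ((W.baseChange E).kummer_isSES hn).exists_map_one_eq_of_map_one_eq_zero a' hy
  refine ⟨cohomologyMap (W.torsionTransferInvHom (E := E) hn) 1 b', ?_⟩
  rw [map_torsionPointsMapIntertwining_cohomologyMap_torsionTransferInvHom, hb']
  exact cohomologyMap_inv_hom_apply (W.pointsLocalIso E).symm 1 a₀

omit [CharZero K] [W.IsElliptic] [CharZero E] in
/-- The image of `H¹(E, E[n]) → H¹(E, E)` is `n`-torsion (`H¹(E, E[n])` is killed by `n`).
Silverman, *AEC*, X.§4. [folklore] -/
theorem zsmul_map_torsionPointsMapIntertwining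
    (b : galoisCohomology (GaloisRep.restrictField E (W.torsionGaloisModule n)) 1) :
    n • galoisCohomology.map (W.torsionPointsMapIntertwining n E) 1 b = 0 := by
  rw [← map_zsmul]
  obtain ⟨φ, rfl⟩ := oneCocycleClass_surjective
    (DiscreteGaloisModule.toTopRep (GaloisRep.restrictField E (W.torsionGaloisModule n))) b
  have hφ : n • φ = 0 := Subtype.ext (ContinuousMap.ext fun σ => Subtype.ext (by
    change n • ((φ.1 σ : geomTorsion W n) : geomPoints W) = ((0 : geomTorsion W n) : geomPoints W)
    exact (mem_geomTorsion_iff W n _).mp (φ.1 σ).2))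
  have h1 := (oneCocycleClass_smul
    (X := DiscreteGaloisModule.toTopRep (GaloisRep.restrictField E (W.torsionGaloisModule n))) n φ).symm
  rw [hφ, oneCocycleClass_zero] at h1
  have h2 := (Int.cast_smul_eq_zsmul ℤ n (oneCocycleClass
    (DiscreteGaloisModule.toTopRep (GaloisRep.restrictField E (W.torsionGaloisModule n))) φ)).symm.trans h1
  exact (congrArg (galoisCohomology.map (W.torsionPointsMapIntertwining n E) 1) h2).trans (map_zero _)

/-- **The image of `H¹(E, E[n]) → H¹(E, E)` is exactly `H¹(E, E)[n]`.** Silverman, *AEC*, X.§4,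
diagram (**). [cite: SilvermanAEC2009, X.§4 diagram (**)] -/
theorem mem_range_map_torsionPointsMapIntertwining_iff (hn : n ≠ 0)
    (a : galoisCohomology (W.localGaloisModule E) 1) :
    a ∈ (galoisCohomology.map (W.torsionPointsMapIntertwining n E) 1).range ↔ n • a = 0 := by
  constructor
  · rintro ⟨b, rfl⟩
    exact W.zsmul_map_torsionPointsMapIntertwining E b
  · intro ha
    obtain ⟨b, hb⟩ := W.exists_map_torsionPointsMapIntertwining_eq_of_zsmul_eq_zero E hn a ha
    exact ⟨b, hb⟩

/-- The image of `H¹(E, E[n]) → H¹(E, E)` as a subgroup: `range = H¹(E, E)[n]`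
(`AddSubgroup.torsionBy`). [cite: SilvermanAEC2009, X.§4 diagram (**)] -/
theorem range_map_torsionPointsMapIntertwining (hn : n ≠ 0) :
    (galoisCohomology.map (W.torsionPointsMapIntertwining n E) 1).range =
      AddSubgroup.torsionBy (galoisCohomology (W.localGaloisModule E) 1) n := by
  ext a
  rw [W.mem_range_map_torsionPointsMapIntertwining_iff E hn, AddSubgroup.torsionBy,
    Submodule.mem_toAddSubgroup, Submodule.mem_torsionBy_iff]

/-- **`H¹(E, E[n]) / 𝓛_E ≃+ H¹(E, E)[n]`**: the change of coefficients induces an isomorphism of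
`H¹(Γ_E, E[n](K̄)|_{Γ_E})` modulo the local Kummer condition (its kernel) onto the `n`-torsion of
`H¹(Γ_E, E(K̄_E))` (first isomorphism theorem). Silverman, *AEC*, X.§4 (**); Milne, *ADT*, I §6.
[folklore] -/
def quotientKummerLocalConditionAtEquivTorsionBy (hn : n ≠ 0) :
    galoisCohomology (GaloisRep.restrictField E (W.torsionGaloisModule n)) 1 ⧸
        W.kummerLocalConditionAt n E ≃+
      AddSubgroup.torsionBy (galoisCohomology (W.localGaloisModule E) 1) n :=
  (QuotientAddGroup.quotientKerEquivRange
      (galoisCohomology.map (W.torsionPointsMapIntertwining n E) 1)).trans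
    (AddEquiv.addSubgroupCongr (W.range_map_torsionPointsMapIntertwining E hn))

/-- **`#H¹(E, E)[n] · #𝓛_E = #H¹(E, E[n])`** (both sides `0` if infinite): the order relation of the
exact sequence `0 → 𝓛_E → H¹(E, E[n]) → H¹(E, E)[n] → 0`. With `#𝓛_{K_v} = #E(K_v)/n`
(`natCard_kummerLocalConditionAt_adicCompletion`) and the local Euler characteristic this is the
order computation of Milne, *ADT*, I Thm. 3.2 / Lemma 3.3 (`#H¹(K_v, E)[n] = #E(K_v)/n`).
[cite: MilneADT2006, I Lemma 3.3] [cite: SilvermanAEC2009, X.§4 diagram (**)] -/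
theorem natCard_torsionBy_mul_natCard_kummerLocalConditionAt (hn : n ≠ 0) :
    Nat.card (AddSubgroup.torsionBy (galoisCohomology (W.localGaloisModule E) 1) n) *
        Nat.card (W.kummerLocalConditionAt n E) =
      Nat.card (galoisCohomology (GaloisRep.restrictField E (W.torsionGaloisModule n)) 1) := by
  rw [← Nat.card_congr (W.quotientKummerLocalConditionAtEquivTorsionBy E hn).toEquiv]
  exact (AddSubgroup.card_eq_card_quotient_mul_card_addSubgroup _).symm

end WeierstrassCurve

end
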